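/-
Copyright (c) 2026 the pub-hodgecm-mathlib formalisation cell (harness21).  Prover seat hodgecm-mathlib-K2E2-p12 (g6): Track B «K2-LIT», ENGINE E1,
h413 = stmt-HodgeConjecture-24833; R8₂-sph ROAD T′, road (A) GELFAND, deal (128)(i) of K2E1-plan (g7): RESTRICTED-PRODUCT GLUING of the letter `hcommHecke` of ★ (A3) p859707.
-/
import Mathlib.RepresentationTheory.Continuous.Basic
import Mathlib.Analysis.InnerProductSpace.Projection.Basic
import Mathlib.Algebra.Group.Subgroup.Pointwise
import Mathlib.GroupTheory.Subgroup.Centralizer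
import Mathlib.Order.CompleteLattice.Finset
import HarnessLib

/-!
# K2·E1 — `K2E1HeckeCommuteGluingU` (deal (128)(i), road (A) GELFAND): LOCAL COMMUTATIVITY OF THE HECKE OPERATORS AT EVERY PLACE ⇒ GLOBAL COMMUTATIVITY — the letter
# `hcommHecke` of ★ `K2E1ResidualSphericalMultiplicityOneOfLetters` from per-place letters [Flath 1979 §2, Thm. 2; Bump 1997 §3.4 and Thm. 3.3.3∕4.6.1; Cartier 1979 §IV.1]

Track B ∕ K2-LIT, crux h413 = `stmt-HodgeConjecture-24833`, route of record `HCCMUnconditional`; cell `hodgecm-mathlib`, squad K2, ENGINE E1 (R8₂-sph ROAD T′, road (A) of the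
(ADM) census ∕ ruling (110), step (i) of deal (128)).  THEOREMS ONLY (no `def`, no `instance`, no notation, no `sorry`; default heartbeats); lane
`--supports stmt-HodgeConjecture-24833 --as helper` (count-neutral).  HYPOTHESIS-FIRST and PURELY ALGEBRAIC (any monoid `M` of operators, any group `G`):

THE DATA (all abstract; the instance of record is `G = U(Φ_N)(𝔸_{L⁺})`, `M = 𝓑(L²)`, `ρ = R`, places `ι`, local groups `H v = U(Φ_N)(L⁺_v)` with their commuting embeddings
`φ v : H v →* G`, `K = K_U = ∏_v K_v`, `Pl v` = the projection onto the `K_v`-fixed vectors, `Pout T` = the projection onto the vectors fixed by `K^T = ∏_{v ∉ T} K_v` (`T` a finite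
set of places), `P = Pout ∅ = P_K`):
* (C) local images at distinct places commute; (L1) `Pl v` commutes with `ρ(φ_w y)` for `w ≠ v`;
* (F1) PEELING `Pout T = Pl v * Pout (insert v T)` for `v ∉ T`; (F2) `Pout T` commutes with `ρ(φ_v x)` for `v ∈ T`; (F3) `Pout T` commutes with every `Pl v`;
* (SUPP) every `g ∈ G` is `l · k` with `k ∈ K` and `l` in the subgroup generated by FINITELY many local images; (K) `ρ k * P = P` for `k ∈ K`;
* (LOC) THE PER-PLACE LETTERS: for every place `v`, the local Hecke operators `Pl v * ρ(φ_v x) * Pl v` (`x ∈ H v`) pairwise commute — i.e. `(H v, K_v)` is a Gelfand pair, read on the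
  representation `ρ ∘ φ_v` (Satake at unramified `v`, [Macdonald1971] at special maximal compacts, Gelfand's trick at `∞`).
THE CONCLUSION: the global Hecke operators `P * ρ g * P` (`g ∈ G`) pairwise commute (**`commute_sandwich_of_local`**), and, read pointwise on any subspace `E` fixed by `P`, the letter
`hcommHecke : ∀ g₁ g₂, ∀ v ∈ E, P (π g₁ (P (π g₂ v))) = P (π g₂ (P (π g₁ v)))` of ★ (A3) VERBATIM (**`hcommHecke_of_local`**).
THE PROOF (Flath's `𝓗(G, K) ≅ ⊗'_v 𝓗(G_v, K_v)` read on operators, no measure, no tensor product): by induction on the finite support `S`, for `T` disjoint from `S` and `l, l'` in the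
subgroup `L_S` generated by the images at the places of `S`, the sandwiches `Pout T * ρ l * Pout T` commute: peel `v ∈ S` off, `l = x m` (`x` at `v`, `m ∈ L_{S∖v}` — the images
commute, so `L_S = φ_v(H_v) · L_{S∖v}`), `Pout T ρ(x m) Pout T = (Pl v ρ(x) Pl v) · (Pout (T ∪ {v}) ρ(m) Pout (T ∪ {v}))`, the two factors living in commuting blocks; the first factors
commute by (LOC), the second by induction.  At `T = ∅` and with (SUPP)(K): `P ρ(g) P = P ρ(l) P`.
* §1 closure lemmas (`commute_of_mem_iSup_range`, `map_commute_of_mem_iSup_range`, `exists_mul_eq_of_mem_sup_of_commute`).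
* §2 **`commute_sandwich_iSup_of_local`** (the induction), **`commute_sandwich_of_local`** (all `g, g' ∈ G`).
* §3 `ContRepresentation` edition, pointwise, in ★ (A3)'s letter bytes: **`hcommHecke_of_local`** (generic `P`); §4 **`hcommHecke_starProjection_of_local`** (`P = Kfix.starProjection`,
  conclusion = the letter of ★ `hadm_of_hcommHecke` ∕ `cmResidualSubspaceR_hadm_of_hcommHecke` byte for byte).
HONEST LABEL: HC_CM is proved only modulo the 7 printed citations (2 remaining named inputs: hLiu418 = `stmt-HodgeConjecture-24832`, h413 = `stmt-HodgeConjecture-24833`) until rung 0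
closes; this file asserts no named fact and closes no socket; count-neutral; the per-place letters (LOC) and the bookkeeping (C)(L1)(F1)–(F3)(SUPP)(K) are hypotheses.

## References
* [Flath1979] D. Flath, *Decomposition of representations into tensor products*, PSPM 33.1 (1979): §2 Example 2, Thm. 2 (`𝓗(G, K) ≅ ⊗'_v 𝓗(G_v, K_v)`).
* [Bump1997] D. Bump, *Automorphic Forms and Representations* (1997): §3.4 (pp. 314–315), Thm. 3.3.3, Thm. 4.6.1 (local Gelfand pairs), Thm. 2.4.2.
* [CartierCorvallis1979] P. Cartier, *Representations of 𝔭-adic groups: a survey*, PSPM 33.1 (1979): §IV.1.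
* [Macdonald1971] I. G. Macdonald, *Spherical functions on a group of p-adic type* (1971): Thm. 3.3.6.
-/

set_option autoImplicit false
set_option linter.dupNamespace false -- the mandated namespace repeats `HodgeConjecture.HodgeConjecture`

namespace Summit.HodgeConjecture.HodgeConjecture.Cruxes.H413.K2E1HeckeCommuteGluingU

/-! ## §1 Closure lemmas: commuting with the subgroup generated by finitely many local images -/

section Closure

variable {ι G : Type*} [Group G] {H : ι → Type*} [∀ v, Group (H v)] (φ : ∀ v, H v →* G)

/-- If `g` commutes with every local image `φ_w(y)`, `w ∈ S`, then `g` commutes with the subgroup `⨆_{w ∈ S} φ_w(H_w)` they generate (a centraliser is a subgroup). [cite: Flath1979, §2] -/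
theorem commute_of_mem_iSup_range (S : Finset ι) {g : G} (hg : ∀ w ∈ S, ∀ y : H w, Commute g (φ w y)) :
    ∀ m ∈ ⨆ w ∈ S, (φ w).range, Commute g m := by
  have hle : (⨆ w ∈ S, (φ w).range) ≤ Subgroup.centralizer ({g} : Set G) := by
    refine iSup₂_le fun w hw => ?_
    rintro _ ⟨y, rfl⟩
    rw [Subgroup.mem_centralizer_iff]
    intro h hh
    rw [Set.mem_singleton_iff.1 hh]
    exact (hg w hw y).eq
  intro m hm
  have h := (Subgroup.mem_centralizer_iff.1 (hle hm)) g (Set.mem_singleton g)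
  exact h

/-- The same through a monoid homomorphism `ρ : G →* M` (e.g. a representation): an operator `A` commuting with every `ρ(φ_w y)`, `w ∈ S`, commutes with `ρ(m)` for `m` in the subgroup
generated by these local images (the `m` with `A ρ(m) = ρ(m) A` form a subgroup). [cite: Flath1979, §2] -/
theorem map_commute_of_mem_iSup_range {M : Type*} [Monoid M] (ρ : G →* M) (S : Finset ι) {A : M}
    (hA : ∀ w ∈ S, ∀ y : H w, Commute A (ρ (φ w y))) : ∀ m ∈ ⨆ w ∈ S, (φ w).range, Commute A (ρ m) := by
  -- the elements `m` with `Commute A (ρ m)` form a subgroup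
  let C : Subgroup G :=
    { carrier := {m : G | Commute A (ρ m)}
      mul_mem' := fun {a b} ha hb => by
        simp only [Set.mem_setOf_eq, map_mul] at ha hb ⊢
        exact ha.mul_right hb
      one_mem' := by simp only [Set.mem_setOf_eq, map_one]; exact Commute.one_right A
      inv_mem' := fun {a} ha => by
        simp only [Set.mem_setOf_eq] at ha ⊢
        calc A * ρ a⁻¹ = (ρ a⁻¹ * ρ a) * A * ρ a⁻¹ := by rw [← map_mul, inv_mul_cancel, map_one, one_mul]
          _ = ρ a⁻¹ * (A * ρ a) * ρ a⁻¹ := by rw [mul_assoc (ρ a⁻¹), ha.eq]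
          _ = ρ a⁻¹ * A * (ρ a * ρ a⁻¹) := by simp only [mul_assoc]
          _ = ρ a⁻¹ * A := by rw [← map_mul, mul_inv_cancel, map_one, mul_one] }
  have hle : (⨆ w ∈ S, (φ w).range) ≤ C := by
    refine iSup₂_le fun w hw => ?_
    rintro _ ⟨y, rfl⟩
    exact hA w hw y
  exact fun m hm => hle hm

/-- In a join of two subgroups that commute elementwise every element is a product: `l ∈ A ⊔ B ⇒ l = a b` (`A` normalises `B`; Mathlib `coe_mul_of_left_le_normalizer_right`). [cite: Flath1979, §2] -/
theorem exists_mul_eq_of_mem_sup_of_commute (A B : Subgroup G) (hAB : ∀ a ∈ A, ∀ b ∈ B, Commute a b) {l : G} (hl : l ∈ A ⊔ B) :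
    ∃ a ∈ A, ∃ b ∈ B, a * b = l := by
  have hle : A ≤ Subgroup.normalizer (B : Set G) := by
    refine le_trans (fun a ha => ?_) (Subgroup.centralizer_le_normalizer (B : Set G))
    rw [Subgroup.mem_centralizer_iff]
    exact fun b hb => ((hAB a ha b hb).eq).symm
  have h : l ∈ ((A ⊔ B : Subgroup G) : Set G) := hl
  rw [Subgroup.coe_mul_of_left_le_normalizer_right A B hle] at h
  obtain ⟨a, ha, b, hb, hab⟩ := Set.mem_mul.1 h
  exact ⟨a, ha, b, hb, hab⟩

end Closure

/-! ## §2 THE GLUING (monoid form): per-place commutativity ⇒ the global sandwiches `P ρ(g) P` commute -/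

section Gluing

variable {ι G M : Type*} [DecidableEq ι] [Group G] [Monoid M] {H : ι → Type*} [∀ v, Group (H v)]
  (ρ : G →* M) (φ : ∀ v, H v →* G) (Pl : ι → M) (Pout : Finset ι → M)

/-- **THE INDUCTION** (Flath's `𝓗(G,K) = ⊗'𝓗(G_v,K_v)` on operators): under (C)(L1)(F1)(F2)(F3) and the per-place letters (LOC), for every finite set of places `S`, every finite `T` disjoint
from `S`, and all `l, l'` in the subgroup generated by the local images at the places of `S`, the sandwiches `Pout T * ρ l * Pout T` and `Pout T * ρ l' * Pout T` commute.  Step: peel a place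
`v ∈ S`, `l = x·m`; then `Pout T ρ(xm) Pout T = (Pl v ρ(x) Pl v)(Pout (T∪{v}) ρ(m) Pout (T∪{v}))` with the two factors in elementwise-commuting blocks, (LOC) at `v`, induction for `m`.
[cite: Flath1979, §2 Example 2 and Thm. 2] [cite: Bump1997, §3.4 (pp. 314–315)] [cite: CartierCorvallis1979, §IV.1] -/
theorem commute_sandwich_iSup_of_local
    (hC : ∀ v w : ι, v ≠ w → ∀ (x : H v) (y : H w), Commute (φ v x) (φ w y))
    (hL1 : ∀ v w : ι, v ≠ w → ∀ y : H w, Commute (Pl v) (ρ (φ w y)))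
    (hF1 : ∀ T : Finset ι, ∀ v ∉ T, Pout T = Pl v * Pout (insert v T))
    (hF2 : ∀ T : Finset ι, ∀ v ∈ T, ∀ x : H v, Commute (Pout T) (ρ (φ v x)))
    (hF3 : ∀ (T : Finset ι) (v : ι), Commute (Pout T) (Pl v))
    (hLOC : ∀ (v : ι) (x y : H v), Commute (Pl v * ρ (φ v x) * Pl v) (Pl v * ρ (φ v y) * Pl v)) :
    ∀ S T : Finset ι, Disjoint S T → ∀ l ∈ ⨆ w ∈ S, (φ w).range, ∀ l' ∈ ⨆ w ∈ S, (φ w).range,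
      Commute (Pout T * ρ l * Pout T) (Pout T * ρ l' * Pout T) := by
  intro S
  induction S using Finset.induction_on with
  | empty =>
    intro T _ l hl l' hl'
    have h0 : (⨆ w ∈ (∅ : Finset ι), (φ w).range) = ⊥ := by simp
    rw [h0, Subgroup.mem_bot] at hl hl'
    rw [hl, hl']
  | insert v S hvS ih =>
    intro T hT l hl l' hl'
    have hvT : v ∉ T := Finset.disjoint_left.1 hT (Finset.mem_insert_self v S)
    have hST : Disjoint S (insert v T) := by
      rw [Finset.disjoint_insert_right]
      exact ⟨hvS, (Finset.disjoint_insert_left.1 hT).2⟩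
    -- decompose `l = x * m`, `l' = x' * m'`
    rw [Finset.iSup_insert] at hl hl'
    have hcomm : ∀ a ∈ (φ v).range, ∀ b ∈ ⨆ w ∈ S, (φ w).range, Commute a b := by
      rintro _ ⟨x, rfl⟩ b hb
      exact commute_of_mem_iSup_range φ S (fun w hw y => hC v w (fun h => hvS (h ▸ hw)) x y) b hb
    obtain ⟨_, ⟨x, rfl⟩, m, hm, rfl⟩ := exists_mul_eq_of_mem_sup_of_commute _ _ hcomm hl
    obtain ⟨_, ⟨x', rfl⟩, m', hm', rfl⟩ := exists_mul_eq_of_mem_sup_of_commute _ _ hcomm hl'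
    -- the blocks: `A z := Pl v ρ(φ_v z) Pl v` (place `v`) and `B b := R ρ(b) R`, `R := Pout (T ∪ {v})` (the places of `S`)
    set R : M := Pout (insert v T) with hR
    have hRx : ∀ z : H v, Commute R (ρ (φ v z)) := fun z => hF2 _ v (Finset.mem_insert_self v T) z
    have hRPl : Commute R (Pl v) := hF3 _ v
    have hPlm : ∀ b ∈ ⨆ w ∈ S, (φ w).range, Commute (Pl v) (ρ b) :=
      map_commute_of_mem_iSup_range φ ρ S fun w hw y => hL1 v w (fun h => hvS (h ▸ hw)) y
    have hxm : ∀ (z : H v), ∀ b ∈ ⨆ w ∈ S, (φ w).range, Commute (ρ (φ v z)) (ρ b) := fun z b hb =>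
      (commute_of_mem_iSup_range φ S (fun w hw y => hC v w (fun h => hvS (h ▸ hw)) z y) b hb).map ρ
    -- factorisation of the sandwiches
    have hfac : ∀ (z : H v), ∀ b ∈ ⨆ w ∈ S, (φ w).range,
        Pout T * ρ (φ v z * b) * Pout T = (Pl v * ρ (φ v z) * Pl v) * (R * ρ b * R) := by
      intro z b hb
      rw [hF1 T v hvT, map_mul]
      calc Pl v * R * (ρ (φ v z) * ρ b) * (Pl v * R) = Pl v * (R * ρ (φ v z)) * (ρ b * Pl v) * R := by simp only [mul_assoc]
        _ = Pl v * (ρ (φ v z) * R) * (Pl v * ρ b) * R := by rw [(hRx z).eq, ← (hPlm b hb).eq]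
        _ = Pl v * ρ (φ v z) * (R * Pl v) * ρ b * R := by simp only [mul_assoc]
        _ = Pl v * ρ (φ v z) * (Pl v * R) * ρ b * R := by rw [hRPl.eq]
        _ = (Pl v * ρ (φ v z) * Pl v) * (R * ρ b * R) := by simp only [mul_assoc]
    -- cross-block commutation
    have hcross : ∀ (z : H v), ∀ b ∈ ⨆ w ∈ S, (φ w).range, Commute (Pl v * ρ (φ v z) * Pl v) (R * ρ b * R) := by
      intro z b hb
      have h1 : Commute (Pl v) (R * ρ b * R) := ((hRPl.symm).mul_right (hPlm b hb)).mul_right hRPl.symm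
      have h2 : Commute (ρ (φ v z)) (R * ρ b * R) := (((hRx z).symm).mul_right (hxm z b hb)).mul_right (hRx z).symm
      exact (h1.mul_left h2).mul_left h1
    rw [hfac x m hm, hfac x' m' hm']
    have hAA : Commute (Pl v * ρ (φ v x) * Pl v) (Pl v * ρ (φ v x') * Pl v) := hLOC v x x'
    have hBB : Commute (R * ρ m * R) (R * ρ m' * R) := ih (insert v T) hST m hm m' hm'
    exact ((hAA.mul_right (hcross x m' hm'))).mul_left ((hcross x' m hm).symm.mul_right hBB)

/-- **THE GLUING** (all of `G`): under (C)(L1)(F1)(F2)(F3)(LOC), `P = Pout ∅`, (K) `ρ k * P = P` for `k ∈ K`, and (SUPP) «every `g` is `l · k`, `k ∈ K`, `l` generated by finitely many local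
images», the global Hecke operators **`P ρ(g) P`, `g ∈ G`, PAIRWISE COMMUTE**. [cite: Flath1979, §2 Example 2 and Thm. 2] [cite: Bump1997, §3.4 (pp. 314–315) and Thm. 4.6.1] [cite: CartierCorvallis1979, §IV.1] -/
theorem commute_sandwich_of_local
    (hC : ∀ v w : ι, v ≠ w → ∀ (x : H v) (y : H w), Commute (φ v x) (φ w y))
    (hL1 : ∀ v w : ι, v ≠ w → ∀ y : H w, Commute (Pl v) (ρ (φ w y)))
    (hF1 : ∀ T : Finset ι, ∀ v ∉ T, Pout T = Pl v * Pout (insert v T))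
    (hF2 : ∀ T : Finset ι, ∀ v ∈ T, ∀ x : H v, Commute (Pout T) (ρ (φ v x)))
    (hF3 : ∀ (T : Finset ι) (v : ι), Commute (Pout T) (Pl v))
    (hLOC : ∀ (v : ι) (x y : H v), Commute (Pl v * ρ (φ v x) * Pl v) (Pl v * ρ (φ v y) * Pl v))
    (P : M) (hP : P = Pout ∅) {SK : Type*} [SetLike SK G] (K : SK) (hK : ∀ k ∈ K, ρ k * P = P)
    (hSUPP : ∀ g : G, ∃ S : Finset ι, ∃ l ∈ ⨆ w ∈ S, (φ w).range, ∃ k ∈ K, g = l * k) :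
    ∀ g g' : G, Commute (P * ρ g * P) (P * ρ g' * P) := by
  intro g g'
  obtain ⟨S, l, hl, k, hk, rfl⟩ := hSUPP g
  obtain ⟨S', l', hl', k', hk', rfl⟩ := hSUPP g'
  -- absorb `k`, `k'`
  have habs : ∀ (a b : G), b ∈ K → P * ρ (a * b) * P = P * ρ a * P := fun a b hb => by
    rw [map_mul, mul_assoc, mul_assoc, hK b hb, ← mul_assoc]
  rw [habs l k hk, habs l' k' hk', hP]
  -- both supports inside `S ∪ S'`
  have hmono : ∀ {U U' : Finset ι}, U ⊆ U' → (⨆ w ∈ U, (φ w).range) ≤ ⨆ w ∈ U', (φ w).range :=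
    fun hU => biSup_mono fun w hw => hU hw
  exact commute_sandwich_iSup_of_local ρ φ Pl Pout hC hL1 hF1 hF2 hF3 hLOC (S ∪ S') ∅ (Finset.disjoint_empty_right _)
    l (hmono Finset.subset_union_left hl) l' (hmono Finset.subset_union_right hl')

end Gluing

/-! ## §3 `ContRepresentation` edition, pointwise: the letter `hcommHecke` of ★ (A3) `K2E1ResidualSphericalMultiplicityOneOfLetters` from the per-place letters -/

section Rep

variable {ι G R V : Type*} [DecidableEq ι] [Group G] [Ring R] [AddCommGroup V] [TopologicalSpace V] [IsTopologicalAddGroup V] [Module R V]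
  (π : ContRepresentation R G V) {H : ι → Type*} [∀ v, Group (H v)] (φ : ∀ v, H v →* G) (Pl : ι → (V →L[R] V)) (Pout : Finset ι → (V →L[R] V))

/-- **`hcommHecke` FROM THE PER-PLACE LETTERS, IN ★ (A3)'s BYTES.**  For a representation `π` of `G` by bounded operators, local data (C)(L1)(F1)(F2)(F3), the per-place Gelfand letters
(LOC) `∀ v x y, Commute (Pl v ∘ π(φ_v x) ∘ Pl v) (Pl v ∘ π(φ_v y) ∘ Pl v)`, `P = Pout ∅` idempotent with (K) `π k ∘ P = P` (`k ∈ K`) and (SUPP), and ANY subspace `E` fixed pointwise by `P`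
(e.g. `E = L²_res ⊓ Kfix`): **`∀ g₁ g₂, ∀ v ∈ E, P (π g₁ (P (π g₂ v))) = P (π g₂ (P (π g₁ v)))`** — the letter `hcommHecke` of ★ `hadm_of_commute` ∕ `hadm_of_hcommHecke` ∕
`cmResidualSubspaceR_hadm_of_hcommHecke` verbatim. [cite: Flath1979, §2 Example 2 and Thm. 2] [cite: Bump1997, Thm. 2.4.2 and Thm. 4.6.1] [cite: CartierCorvallis1979, §IV.1] -/
theorem hcommHecke_of_local
    (hC : ∀ v w : ι, v ≠ w → ∀ (x : H v) (y : H w), Commute (φ v x) (φ w y))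
    (hL1 : ∀ v w : ι, v ≠ w → ∀ y : H w, Commute (Pl v) (π (φ w y)))
    (hF1 : ∀ T : Finset ι, ∀ v ∉ T, Pout T = Pl v * Pout (insert v T))
    (hF2 : ∀ T : Finset ι, ∀ v ∈ T, ∀ x : H v, Commute (Pout T) (π (φ v x)))
    (hF3 : ∀ (T : Finset ι) (v : ι), Commute (Pout T) (Pl v))
    (hLOC : ∀ (v : ι) (x y : H v), Commute (Pl v * π (φ v x) * Pl v) (Pl v * π (φ v y) * Pl v))
    (P : V →L[R] V) (hP : P = Pout ∅) (hPP : ∀ w : V, P (P w) = P w) {SK : Type*} [SetLike SK G] (K : SK) (hK : ∀ k ∈ K, ∀ w : V, π k (P w) = P w)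
    (hSUPP : ∀ g : G, ∃ S : Finset ι, ∃ l ∈ ⨆ w ∈ S, (φ w).range, ∃ k ∈ K, g = l * k)
    (E : Submodule R V) (hPE : ∀ v ∈ E, P v = v) :
    ∀ g₁ g₂ : G, ∀ v ∈ E, P (π g₁ (P (π g₂ v))) = P (π g₂ (P (π g₁ v))) := by
  intro g₁ g₂ v hv
  have hK' : ∀ k ∈ K, π.toMonoidHom k * P = P := fun k hk => ContinuousLinearMap.ext fun w => hK k hk w
  have h := commute_sandwich_of_local π.toMonoidHom φ Pl Pout hC hL1 hF1 hF2 hF3 hLOC P hP K hK' hSUPP g₁ g₂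
  have hcoe : ∀ g : G, π.toMonoidHom g = π g := fun _ => rfl
  have h' := congrArg (fun T : V →L[R] V => T v) h.eq
  simp only [mul_apply_eq_comp, hcoe, hPE v hv, hPP] at h'
  exact h'

end Rep

/-! ## §4 Hilbert-space edition with `P = Kfix.starProjection` (the dealer's bytes of ★ (A3) `hadm_of_hcommHecke` ∕ `cmResidualSubspaceR_hadm_of_hcommHecke`) -/

section Hilbert

variable {ι G V : Type*} [DecidableEq ι] [Group G] [NormedAddCommGroup V] [InnerProductSpace ℂ V]
  (π : ContRepresentation ℂ G V) {H : ι → Type*} [∀ v, Group (H v)] (φ : ∀ v, H v →* G) (Pl : ι → (V →L[ℂ] V)) (Pout : Finset ι → (V →L[ℂ] V))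

/-- **`hcommHecke` FROM THE PER-PLACE LETTERS, `P = Kfix.starProjection`** (the orthogonal projection onto the `K`-fixed vectors `Kfix`, assumed to be the empty-support member `Pout ∅` of
the peeling family): for ANY subspace `Res` (think `L²_res`), **`∀ g₁ g₂, ∀ v ∈ Res ⊓ Kfix, P (π g₁ (P (π g₂ v))) = P (π g₂ (P (π g₁ v)))`** — the letter of ★ `hadm_of_hcommHecke` (take
`Res := L²_res.toSubmodule`) and of ★ `cmResidualSubspaceR_hadm_of_hcommHecke` verbatim; (K) and idempotence are automatic (`P v ∈ Kfix` is `K`-fixed; `P|_{Kfix} = id`).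
[cite: Flath1979, §2 Example 2 and Thm. 2] [cite: Bump1997, Thm. 2.4.2 and Thm. 4.6.1] [cite: CartierCorvallis1979, §IV.1] -/
theorem hcommHecke_starProjection_of_local
    (hC : ∀ v w : ι, v ≠ w → ∀ (x : H v) (y : H w), Commute (φ v x) (φ w y))
    (hL1 : ∀ v w : ι, v ≠ w → ∀ y : H w, Commute (Pl v) (π (φ w y)))
    (hF1 : ∀ T : Finset ι, ∀ v ∉ T, Pout T = Pl v * Pout (insert v T))
    (hF2 : ∀ T : Finset ι, ∀ v ∈ T, ∀ x : H v, Commute (Pout T) (π (φ v x)))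
    (hF3 : ∀ (T : Finset ι) (v : ι), Commute (Pout T) (Pl v))
    (hLOC : ∀ (v : ι) (x y : H v), Commute (Pl v * π (φ v x) * Pl v) (Pl v * π (φ v y) * Pl v))
    {SK : Type*} [SetLike SK G] (K : SK) (Kfix : Submodule ℂ V) (hKfix : ∀ v : V, v ∈ Kfix ↔ ∀ k ∈ K, π k v = v) [Kfix.HasOrthogonalProjection]
    (hP : Kfix.starProjection = Pout ∅)
    (hSUPP : ∀ g : G, ∃ S : Finset ι, ∃ l ∈ ⨆ w ∈ S, (φ w).range, ∃ k ∈ K, g = l * k) (Res : Submodule ℂ V) :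
    ∀ g₁ g₂ : G, ∀ v ∈ Res ⊓ Kfix,
      Kfix.starProjection (π g₁ (Kfix.starProjection (π g₂ v))) = Kfix.starProjection (π g₂ (Kfix.starProjection (π g₁ v))) :=
  hcommHecke_of_local π φ Pl Pout hC hL1 hF1 hF2 hF3 hLOC Kfix.starProjection hP
    (fun w => Submodule.starProjection_eq_self_iff.2 (Submodule.starProjection_apply_mem Kfix w)) K
    (fun k hk w => (hKfix _).1 (Submodule.starProjection_apply_mem Kfix w) k hk) hSUPP (Res ⊓ Kfix)
    fun _ hv => Submodule.starProjection_eq_self_iff.2 hv.2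

end Hilbert

end Summit.HodgeConjecture.HodgeConjecture.Cruxes.H413.K2E1HeckeCommuteGluingU
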